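import Mathlib
import HarnessLib
import Literature.MathematicalPhysics.StatisticalMechanics.RenormalisationMapTermBound
import Literature.MathematicalPhysics.StatisticalMechanics.PolymerProductDifference
import Literature.MathematicalPhysics.StatisticalMechanics.FluctuationPolymer

/-!
# The summed submultiplicativity estimate behind [ABKM19] Lemma 9.6, LIPSCHITZ form (abstract):
# `|Σ_X Σ_{X₁} (F₁^{U∖X} F₂^{X∖U} F₃^{X₁} G(X∖X₁) − F₁'^{U∖X} F₂'^{X∖U} F₃'^{X₁} G'(X∖X₁))|_{T,w}`
# `  ≤ Σ_X Σ_{X₁} [ Δ₁ a₂ a₃ g + a₁ Δ₂ a₃ g + a₁ a₂ Δ₃ g + a₁ a₂ a₃ ρ ]`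

(`aᵢ = ∏_B aᵢ(B)`, `Δᵢ = ∏_B (aᵢ(B) + δᵢ(B)) − ∏_B aᵢ(B)` over the blocks of `U∖X`, `X∖U`, `X₁`
respectively; `g`, `ρ` the bounds of `G(X∖X₁)` and `G(X∖X₁) − G'(X∖X₁)`.)

The renormalisation map in reblocked form is `S(H,K)(U) = Σ_{π(X)=U} Σ_{X₁⊆X} (e^{−H̃})^{U∖X}
(e^{H̃})^{X∖U} (1−e^{−H̃})^{X₁} R[P₂(e^{−H},K)(X∖X₁)]` (`GradientRG.nextKStep_eq_sum`).
`RenormalisationMapTermBound.tayNormLE_sum_reblockTerm` bounds it at zeroth order by Lemma 8.3 (iii);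
the Lipschitz estimate of `S` on a ball (the crux line's `IsRGStepQ.lipschitz`, [ABKM19] Thm 6.7 at
first order) needs the same sum for the DIFFERENCE of two such expressions.  Telescoping factor by
factor,
`P₁P₂(P₃G) − P₁'P₂'(P₃'G') = (P₁−P₁')P₂(P₃G) + P₁'(P₂−P₂')(P₃G) + P₁'P₂'((P₃−P₃')G) + P₁'P₂'(P₃'(G−G'))`,
each hybrid term is a four-factor product bounded by `FluctuationPolymer.tayNormLE_mul_four`, with the
block-product differences bounded by `PolymerProductDifference.tayNormLE_bprod_sub_bprod`
(`∏(a+δ) − ∏ a`), under the SAME weight inequality `W^{U∖X} W^{X∖U} W^{X₁} wm^{X∖X₁} ≤ w` as the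
zeroth-order estimate.

* **`tayNormLE_reblockTerm_sub`** — one term;
* **`tayNormLE_sum_reblockTerm_sub`** — the double sum over `X ∈ 𝓧`, `X₁ ∈ 𝓟_s(X)`.

Abstract in gauges and weights (both functionals of a slot obey the same zeroth-order bound `aᵢ`,
resp. `g` for `G` — the bound of `G'` is not needed); the torus instance plugs in `StrongNormExp*` (Lemma 9.3 and its Lipschitz form),
`PolymerProductLipschitzABKM.tayNormLE_P2_sub_abkm` composed with `R_{k+1}` (`tayNormLE_fluct_abkm`), and
`StrongWeightStepP1.prod_strongWeight_sq_mul_midWeight_le_abkm`.  Everything is proved; no named fact.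

## References
* S. Adams, S. Buchholz, R. Kotecký, S. Müller, arXiv:1910.13564, Lemma 9.6 (proof, first display and
  (9.40)–(9.43)), Lemma 8.3 (iii), Theorem 6.7 [AdamsBuchholzKoteckyMuller2019].
-/

noncomputable section

namespace Literature.MathematicalPhysics.StatisticalMechanics.GradientRG

open scoped BigOperators Classical
open Finset
open Literature.MathematicalPhysics.StatisticalMechanics.TorusPolymer (IsPolymer blocks polys bprod mem_polys)
open Literature.MathematicalPhysics.QuantumFieldTheory

variable {d M : ℕ} [NeZero M]
  {V : Type*} [NormedAddCommGroup V] [NormedSpace ℝ V]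
  {Vb : Finset (Fin d → ZMod M) → Type*} [∀ B, NormedAddCommGroup (Vb B)] [∀ B, NormedSpace ℝ (Vb B)]
  {Vp : Finset (Fin d → ZMod M) → Type*} [∀ Y, NormedAddCommGroup (Vp Y)] [∀ Y, NormedSpace ℝ (Vp Y)]

/-- **One reblocked term, Lipschitz form** ([ABKM19] Lemma 8.3 (iii) applied to the four hybrid
terms): for `s`-polymers `U, X` and `X₁ ∈ 𝓟_s(X)`, block functionals `Fᵢ, Fᵢ'` (`i = 1,2,3`) with
`|Fᵢ(B)|, |Fᵢ'(B)| ≤ aᵢ(B)` and `|Fᵢ(B) − Fᵢ'(B)| ≤ δᵢ(B)` in the block norms `|·|_{T_B,W^B}` on the blocks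
of `U∖X`, `X∖U`, `X₁` (`T_B ≤ T`, `C^{r₀}`, local, `aᵢ, δᵢ ≥ 0`), functionals `G, G'` with
`|G| ≤ g`, `|G − G'| ≤ ρ` in `|·|_{T',wm}` (`T' ≤ T`, `g, ρ ≥ 0`), and the weight inequality
`W^{U∖X} W^{X∖U} W^{X₁} wm ≤ w`:
`|F₁^{U∖X}F₂^{X∖U}(F₃^{X₁}G) − F₁'^{U∖X}F₂'^{X∖U}(F₃'^{X₁}G')|_{T,w}
  ≤ Δ₁a₂(a₃g) + a₁Δ₂(a₃g) + a₁a₂(Δ₃g) + a₁a₂(a₃ρ)`.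
[cite: AdamsBuchholzKoteckyMuller2019, Lemma 9.6 (proof) / Lemma 8.3 (iii)] -/
theorem tayNormLE_reblockTerm_sub (s : ℕ) (T : ((Fin d → ZMod M) → ℝ) →ₗ[ℝ] V)
    (Tb : ∀ B : Finset (Fin d → ZMod M), ((Fin d → ZMod M) → ℝ) →ₗ[ℝ] Vb B)
    {V' : Type*} [NormedAddCommGroup V'] [NormedSpace ℝ V'] (T' : ((Fin d → ZMod M) → ℝ) →ₗ[ℝ] V')
    {r₀ : ℕ} {W : Finset (Fin d → ZMod M) → ((Fin d → ZMod M) → ℝ) → ℝ}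
    {wm w : ((Fin d → ZMod M) → ℝ) → ℝ}
    {F₁ F₂ F₃ F₁' F₂' F₃' : Finset (Fin d → ZMod M) → ((Fin d → ZMod M) → ℝ) → ℂ}
    {G G' : ((Fin d → ZMod M) → ℝ) → ℂ} {a₁ a₂ a₃ δ₁ δ₂ δ₃ : Finset (Fin d → ZMod M) → ℝ} {g ρ : ℝ}
    {U X X₁ : Finset (Fin d → ZMod M)} (hU : IsPolymer s U) (hX : IsPolymer s X) (hX₁ : X₁ ∈ polys s X)
    (hF₁ : ∀ B ∈ blocks s (U \ X), TayNormLE (Tb B) r₀ (W B) (F₁ B) (a₁ B))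
    (hF₁' : ∀ B ∈ blocks s (U \ X), TayNormLE (Tb B) r₀ (W B) (F₁' B) (a₁ B))
    (hΔ₁ : ∀ B ∈ blocks s (U \ X), TayNormLE (Tb B) r₀ (W B) (fun φ => F₁ B φ - F₁' B φ) (δ₁ B))
    (hF₁d : ∀ B ∈ blocks s (U \ X), ContDiff ℝ r₀ (F₁ B)) (hF₁'d : ∀ B ∈ blocks s (U \ X), ContDiff ℝ r₀ (F₁' B))
    (hF₁loc : ∀ B ∈ blocks s (U \ X), IsGaugeLocal (Tb B) (F₁ B))
    (hF₁'loc : ∀ B ∈ blocks s (U \ X), IsGaugeLocal (Tb B) (F₁' B))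
    (ha₁ : ∀ B ∈ blocks s (U \ X), 0 ≤ a₁ B) (hδ₁ : ∀ B ∈ blocks s (U \ X), 0 ≤ δ₁ B)
    (hle₁ : ∀ B ∈ blocks s (U \ X), ∀ ξ, ‖Tb B ξ‖ ≤ ‖T ξ‖)
    (hF₂ : ∀ B ∈ blocks s (X \ U), TayNormLE (Tb B) r₀ (W B) (F₂ B) (a₂ B))
    (hF₂' : ∀ B ∈ blocks s (X \ U), TayNormLE (Tb B) r₀ (W B) (F₂' B) (a₂ B))
    (hΔ₂ : ∀ B ∈ blocks s (X \ U), TayNormLE (Tb B) r₀ (W B) (fun φ => F₂ B φ - F₂' B φ) (δ₂ B))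
    (hF₂d : ∀ B ∈ blocks s (X \ U), ContDiff ℝ r₀ (F₂ B)) (hF₂'d : ∀ B ∈ blocks s (X \ U), ContDiff ℝ r₀ (F₂' B))
    (hF₂loc : ∀ B ∈ blocks s (X \ U), IsGaugeLocal (Tb B) (F₂ B))
    (hF₂'loc : ∀ B ∈ blocks s (X \ U), IsGaugeLocal (Tb B) (F₂' B))
    (ha₂ : ∀ B ∈ blocks s (X \ U), 0 ≤ a₂ B) (hδ₂ : ∀ B ∈ blocks s (X \ U), 0 ≤ δ₂ B)
    (hle₂ : ∀ B ∈ blocks s (X \ U), ∀ ξ, ‖Tb B ξ‖ ≤ ‖T ξ‖)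
    (hF₃ : ∀ B ∈ blocks s X₁, TayNormLE (Tb B) r₀ (W B) (F₃ B) (a₃ B))
    (hF₃' : ∀ B ∈ blocks s X₁, TayNormLE (Tb B) r₀ (W B) (F₃' B) (a₃ B))
    (hΔ₃ : ∀ B ∈ blocks s X₁, TayNormLE (Tb B) r₀ (W B) (fun φ => F₃ B φ - F₃' B φ) (δ₃ B))
    (hF₃d : ∀ B ∈ blocks s X₁, ContDiff ℝ r₀ (F₃ B)) (hF₃'d : ∀ B ∈ blocks s X₁, ContDiff ℝ r₀ (F₃' B))
    (hF₃loc : ∀ B ∈ blocks s X₁, IsGaugeLocal (Tb B) (F₃ B))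
    (hF₃'loc : ∀ B ∈ blocks s X₁, IsGaugeLocal (Tb B) (F₃' B))
    (ha₃ : ∀ B ∈ blocks s X₁, 0 ≤ a₃ B) (hδ₃ : ∀ B ∈ blocks s X₁, 0 ≤ δ₃ B)
    (hle₃ : ∀ B ∈ blocks s X₁, ∀ ξ, ‖Tb B ξ‖ ≤ ‖T ξ‖)
    (hG : TayNormLE T' r₀ wm G g)
    (hΔG : TayNormLE T' r₀ wm (fun φ => G φ - G' φ) ρ)
    (hGd : ContDiff ℝ r₀ G) (hG'd : ContDiff ℝ r₀ G') (hGloc : IsGaugeLocal T' G) (hG'loc : IsGaugeLocal T' G')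
    (hg : 0 ≤ g) (hρ : 0 ≤ ρ) (hle' : ∀ ξ, ‖T' ξ‖ ≤ ‖T ξ‖)
    (hw : ∀ φ, (∏ B ∈ blocks s (U \ X), W B φ) * (∏ B ∈ blocks s (X \ U), W B φ) *
      ((∏ B ∈ blocks s X₁, W B φ) * wm φ) ≤ w φ) :
    TayNormLE T r₀ w
      (fun φ => bprod s (fun B => F₁ B φ) (U \ X) * bprod s (fun B => F₂ B φ) (X \ U) *
          (bprod s (fun B => F₃ B φ) X₁ * G φ) -
        bprod s (fun B => F₁' B φ) (U \ X) * bprod s (fun B => F₂' B φ) (X \ U) *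
          (bprod s (fun B => F₃' B φ) X₁ * G' φ))
      (((∏ B ∈ blocks s (U \ X), (a₁ B + δ₁ B)) - ∏ B ∈ blocks s (U \ X), a₁ B) *
          (∏ B ∈ blocks s (X \ U), a₂ B) * ((∏ B ∈ blocks s X₁, a₃ B) * g) +
        (∏ B ∈ blocks s (U \ X), a₁ B) *
          ((∏ B ∈ blocks s (X \ U), (a₂ B + δ₂ B)) - ∏ B ∈ blocks s (X \ U), a₂ B) *
          ((∏ B ∈ blocks s X₁, a₃ B) * g) +
        (∏ B ∈ blocks s (U \ X), a₁ B) * (∏ B ∈ blocks s (X \ U), a₂ B) *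
          (((∏ B ∈ blocks s X₁, (a₃ B + δ₃ B)) - ∏ B ∈ blocks s X₁, a₃ B) * g) +
        (∏ B ∈ blocks s (U \ X), a₁ B) * (∏ B ∈ blocks s (X \ U), a₂ B) *
          ((∏ B ∈ blocks s X₁, a₃ B) * ρ)) := by
  obtain ⟨hX₁X, hX₁p⟩ := mem_polys.1 hX₁
  have hUX : IsPolymer s (U \ X) := hU.sdiff hX
  have hXU : IsPolymer s (X \ U) := hX.sdiff hU
  -- generic smoothness / locality of block products
  have hcd : ∀ {F : Finset (Fin d → ZMod M) → ((Fin d → ZMod M) → ℝ) → ℂ} {Z : Finset (Fin d → ZMod M)},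
      (∀ B ∈ blocks s Z, ContDiff ℝ r₀ (F B)) → ContDiff ℝ r₀ (fun φ => bprod s (fun B => F B φ) Z) := by
    intro F Z hF
    unfold TorusPolymer.bprod
    exact contDiff_prod fun B hB => hF B hB
  have hlc : ∀ {F : Finset (Fin d → ZMod M) → ((Fin d → ZMod M) → ℝ) → ℂ} {Z : Finset (Fin d → ZMod M)},
      (∀ B ∈ blocks s Z, IsGaugeLocal (Tb B) (F B)) → (∀ B ∈ blocks s Z, ∀ ξ, ‖Tb B ξ‖ ≤ ‖T ξ‖) →
        IsGaugeLocal T (fun φ => bprod s (fun B => F B φ) Z) := by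
    intro F Z hF hle
    unfold TorusPolymer.bprod
    exact IsGaugeLocal.prod _ fun B hB => (hF B hB).of_norm_le (hle B hB)
  have hlsub : ∀ {A A' : ((Fin d → ZMod M) → ℝ) → ℂ},
      IsGaugeLocal T A → IsGaugeLocal T A' → IsGaugeLocal T (fun φ => A φ - A' φ) := by
    intro A A' hA hA' φ ψ h
    show A φ - A' φ = A ψ - A' ψ
    rw [hA φ ψ h, hA' φ ψ h]
  have hlsub' : ∀ {A A' : ((Fin d → ZMod M) → ℝ) → ℂ},
      IsGaugeLocal T' A → IsGaugeLocal T' A' → IsGaugeLocal T' (fun φ => A φ - A' φ) := by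
    intro A A' hA hA' φ ψ h
    show A φ - A' φ = A ψ - A' ψ
    rw [hA φ ψ h, hA' φ ψ h]
  -- the block products and their differences
  set P₁ : ((Fin d → ZMod M) → ℝ) → ℂ := fun φ => bprod s (fun B => F₁ B φ) (U \ X) with hP₁
  set P₁' : ((Fin d → ZMod M) → ℝ) → ℂ := fun φ => bprod s (fun B => F₁' B φ) (U \ X) with hP₁'
  set P₂ : ((Fin d → ZMod M) → ℝ) → ℂ := fun φ => bprod s (fun B => F₂ B φ) (X \ U) with hP₂
  set P₂' : ((Fin d → ZMod M) → ℝ) → ℂ := fun φ => bprod s (fun B => F₂' B φ) (X \ U) with hP₂'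
  set P₃ : ((Fin d → ZMod M) → ℝ) → ℂ := fun φ => bprod s (fun B => F₃ B φ) X₁ with hP₃
  set P₃' : ((Fin d → ZMod M) → ℝ) → ℂ := fun φ => bprod s (fun B => F₃' B φ) X₁ with hP₃'
  set w₁ : ((Fin d → ZMod M) → ℝ) → ℝ := fun φ => ∏ B ∈ blocks s (U \ X), W B φ with hw₁
  set w₂ : ((Fin d → ZMod M) → ℝ) → ℝ := fun φ => ∏ B ∈ blocks s (X \ U), W B φ with hw₂
  set w₃ : ((Fin d → ZMod M) → ℝ) → ℝ := fun φ => ∏ B ∈ blocks s X₁, W B φ with hw₃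
  set A₁ : ℝ := ∏ B ∈ blocks s (U \ X), a₁ B with hA₁
  set A₂ : ℝ := ∏ B ∈ blocks s (X \ U), a₂ B with hA₂
  set A₃ : ℝ := ∏ B ∈ blocks s X₁, a₃ B with hA₃
  set D₁ : ℝ := (∏ B ∈ blocks s (U \ X), (a₁ B + δ₁ B)) - ∏ B ∈ blocks s (U \ X), a₁ B with hD₁
  set D₂ : ℝ := (∏ B ∈ blocks s (X \ U), (a₂ B + δ₂ B)) - ∏ B ∈ blocks s (X \ U), a₂ B with hD₂
  set D₃ : ℝ := (∏ B ∈ blocks s X₁, (a₃ B + δ₃ B)) - ∏ B ∈ blocks s X₁, a₃ B with hD₃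
  have b₁ : TayNormLE T r₀ w₁ P₁ A₁ := tayNormLE_bprod s T Tb (U \ X) hF₁ hle₁ hF₁d hF₁loc ha₁
  have b₁' : TayNormLE T r₀ w₁ P₁' A₁ := tayNormLE_bprod s T Tb (U \ X) hF₁' hle₁ hF₁'d hF₁'loc ha₁
  have b₂ : TayNormLE T r₀ w₂ P₂ A₂ := tayNormLE_bprod s T Tb (X \ U) hF₂ hle₂ hF₂d hF₂loc ha₂
  have b₂' : TayNormLE T r₀ w₂ P₂' A₂ := tayNormLE_bprod s T Tb (X \ U) hF₂' hle₂ hF₂'d hF₂'loc ha₂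
  have b₃ : TayNormLE T r₀ w₃ P₃ A₃ := tayNormLE_bprod s T Tb X₁ hF₃ hle₃ hF₃d hF₃loc ha₃
  have b₃' : TayNormLE T r₀ w₃ P₃' A₃ := tayNormLE_bprod s T Tb X₁ hF₃' hle₃ hF₃'d hF₃'loc ha₃
  have e₁ : TayNormLE T r₀ w₁ (fun φ => P₁ φ - P₁' φ) D₁ :=
    tayNormLE_bprod_sub_bprod s T Tb hUX hF₁' hΔ₁ hle₁ hF₁d hF₁'d hF₁loc hF₁'loc ha₁ hδ₁
  have e₂ : TayNormLE T r₀ w₂ (fun φ => P₂ φ - P₂' φ) D₂ :=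
    tayNormLE_bprod_sub_bprod s T Tb hXU hF₂' hΔ₂ hle₂ hF₂d hF₂'d hF₂loc hF₂'loc ha₂ hδ₂
  have e₃ : TayNormLE T r₀ w₃ (fun φ => P₃ φ - P₃' φ) D₃ :=
    tayNormLE_bprod_sub_bprod s T Tb hX₁p hF₃' hΔ₃ hle₃ hF₃d hF₃'d hF₃loc hF₃'loc ha₃ hδ₃
  -- smoothness, locality, signs
  have d₁ : ContDiff ℝ r₀ P₁ := hcd hF₁d
  have d₁' : ContDiff ℝ r₀ P₁' := hcd hF₁'d
  have d₂ : ContDiff ℝ r₀ P₂ := hcd hF₂d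
  have d₂' : ContDiff ℝ r₀ P₂' := hcd hF₂'d
  have d₃ : ContDiff ℝ r₀ P₃ := hcd hF₃d
  have d₃' : ContDiff ℝ r₀ P₃' := hcd hF₃'d
  have l₁ : IsGaugeLocal T P₁ := hlc hF₁loc hle₁
  have l₁' : IsGaugeLocal T P₁' := hlc hF₁'loc hle₁
  have l₂ : IsGaugeLocal T P₂ := hlc hF₂loc hle₂
  have l₂' : IsGaugeLocal T P₂' := hlc hF₂'loc hle₂
  have l₃ : IsGaugeLocal T P₃ := hlc hF₃loc hle₃
  have l₃' : IsGaugeLocal T P₃' := hlc hF₃'loc hle₃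
  have hA₁0 : 0 ≤ A₁ := prod_nonneg ha₁
  have hA₂0 : 0 ≤ A₂ := prod_nonneg ha₂
  have hA₃0 : 0 ≤ A₃ := prod_nonneg ha₃
  have hD0 : ∀ {Z : Finset (Fin d → ZMod M)} {a δ : Finset (Fin d → ZMod M) → ℝ},
      (∀ B ∈ blocks s Z, 0 ≤ a B) → (∀ B ∈ blocks s Z, 0 ≤ δ B) →
        0 ≤ (∏ B ∈ blocks s Z, (a B + δ B)) - ∏ B ∈ blocks s Z, a B := by
    intro Z a δ ha hδ
    exact sub_nonneg.2 (prod_le_prod ha fun B hB => le_add_of_nonneg_right (hδ B hB))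
  have hD₁0 : 0 ≤ D₁ := hD0 ha₁ hδ₁
  have hD₂0 : 0 ≤ D₂ := hD0 ha₂ hδ₂
  have hD₃0 : 0 ≤ D₃ := hD0 ha₃ hδ₃
  have hTle : ∀ ξ : (Fin d → ZMod M) → ℝ, ‖T ξ‖ ≤ ‖T ξ‖ := fun ξ => le_rfl
  -- the four hybrid terms
  have t₁ := tayNormLE_mul_four (T := T) (w := w) e₁ b₂ b₃ hG hTle hTle hTle hle'
    (d₁.sub d₁') d₂ d₃ hGd (hlsub l₁ l₁') l₂ l₃ hGloc hD₁0 hA₂0 hA₃0 hg hw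
  have t₂ := tayNormLE_mul_four (T := T) (w := w) b₁' e₂ b₃ hG hTle hTle hTle hle'
    d₁' (d₂.sub d₂') d₃ hGd l₁' (hlsub l₂ l₂') l₃ hGloc hA₁0 hD₂0 hA₃0 hg hw
  have t₃ := tayNormLE_mul_four (T := T) (w := w) b₁' b₂' e₃ hG hTle hTle hTle hle'
    d₁' d₂' (d₃.sub d₃') hGd l₁' l₂' (hlsub l₃ l₃') hGloc hA₁0 hA₂0 hD₃0 hg hw
  have t₄ := tayNormLE_mul_four (T := T) (w := w) b₁' b₂' b₃' hΔG hTle hTle hTle hle'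
    d₁' d₂' d₃' (hGd.sub hG'd) l₁' l₂' l₃' (hlsub' hGloc hG'loc) hA₁0 hA₂0 hA₃0 hρ hw
  have s₁₂ := TayNormLE.add (T := T) (w := w) t₁ t₂
    (((d₁.sub d₁').mul d₂).mul (d₃.mul hGd)) ((d₁'.mul (d₂.sub d₂')).mul (d₃.mul hGd))
  have s₁₂₃ := TayNormLE.add (T := T) (w := w) s₁₂ t₃
    ((((d₁.sub d₁').mul d₂).mul (d₃.mul hGd)).add ((d₁'.mul (d₂.sub d₂')).mul (d₃.mul hGd)))
    ((d₁'.mul d₂').mul ((d₃.sub d₃').mul hGd))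
  have s₁₂₃₄ := TayNormLE.add (T := T) (w := w) s₁₂₃ t₄
    (((((d₁.sub d₁').mul d₂).mul (d₃.mul hGd)).add ((d₁'.mul (d₂.sub d₂')).mul (d₃.mul hGd))).add
      ((d₁'.mul d₂').mul ((d₃.sub d₃').mul hGd)))
    ((d₁'.mul d₂').mul (d₃'.mul (hGd.sub hG'd)))
  -- the telescoping identity
  have hfun : (fun φ => bprod s (fun B => F₁ B φ) (U \ X) * bprod s (fun B => F₂ B φ) (X \ U) *
          (bprod s (fun B => F₃ B φ) X₁ * G φ) -
        bprod s (fun B => F₁' B φ) (U \ X) * bprod s (fun B => F₂' B φ) (X \ U) *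
          (bprod s (fun B => F₃' B φ) X₁ * G' φ)) =
      ((fun φ => P₁ φ - P₁' φ) * P₂ * (P₃ * G) + P₁' * (fun φ => P₂ φ - P₂' φ) * (P₃ * G) +
        P₁' * P₂' * ((fun φ => P₃ φ - P₃' φ) * G) + P₁' * P₂' * (P₃' * fun φ => G φ - G' φ)) := by
    funext φ
    simp only [Pi.add_apply, Pi.mul_apply, hP₁, hP₁', hP₂, hP₂', hP₃, hP₃']
    ring
  rw [hfun]
  exact s₁₂₃₄

/-- **The summed Lipschitz estimate** ([ABKM19] Lemma 9.6 at first order): for `s`-polymers `U` and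
`X ∈ 𝓧`, block functionals `Fᵢ, Fᵢ'` bounded (by the same `aᵢ ≥ 0`, differences by `δᵢ ≥ 0`) on a set of
blocks `𝓑` containing all blocks of `U∖X`, `X∖U`, `X`, polymer functionals `G, G'` with
`|G(X∖X₁)| ≤ g(X∖X₁)`, `|G(X∖X₁) − G'(X∖X₁)| ≤ ρ(X∖X₁)` in `|·|_{T_{X∖X₁}, wm^{X∖X₁}}`, and the
weight inequality `W^{U∖X} W^{X∖U} W^{X₁} wm^{X∖X₁} ≤ w`:
`|Σ_X Σ_{X₁} (F₁^{U∖X}F₂^{X∖U}F₃^{X₁}G(X∖X₁) − F₁'^{U∖X}F₂'^{X∖U}F₃'^{X₁}G'(X∖X₁))|_{T,w}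
  ≤ Σ_X Σ_{X₁} [Δ₁a₂(a₃g) + a₁Δ₂(a₃g) + a₁a₂(Δ₃g) + a₁a₂(a₃ρ)]`.
[cite: AdamsBuchholzKoteckyMuller2019, Lemma 9.6 (proof, (9.40)–(9.43) at first order)] -/
theorem tayNormLE_sum_reblockTerm_sub (s : ℕ) (T : ((Fin d → ZMod M) → ℝ) →ₗ[ℝ] V)
    (Tb : ∀ B : Finset (Fin d → ZMod M), ((Fin d → ZMod M) → ℝ) →ₗ[ℝ] Vb B)
    (Tp : ∀ Y : Finset (Fin d → ZMod M), ((Fin d → ZMod M) → ℝ) →ₗ[ℝ] Vp Y) {r₀ : ℕ}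
    {W wm : Finset (Fin d → ZMod M) → ((Fin d → ZMod M) → ℝ) → ℝ} {w : ((Fin d → ZMod M) → ℝ) → ℝ}
    {F₁ F₂ F₃ F₁' F₂' F₃' G G' : Finset (Fin d → ZMod M) → ((Fin d → ZMod M) → ℝ) → ℂ}
    {a₁ a₂ a₃ δ₁ δ₂ δ₃ g ρ : Finset (Fin d → ZMod M) → ℝ}
    (𝓧 𝓑 : Finset (Finset (Fin d → ZMod M))) {U : Finset (Fin d → ZMod M)} (hU : IsPolymer s U)
    (h𝓧 : ∀ X ∈ 𝓧, IsPolymer s X)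
    (h𝓑₁ : ∀ X ∈ 𝓧, blocks s (U \ X) ⊆ 𝓑) (h𝓑₂ : ∀ X ∈ 𝓧, blocks s (X \ U) ⊆ 𝓑)
    (h𝓑₃ : ∀ X ∈ 𝓧, blocks s X ⊆ 𝓑)
    (hle : ∀ B ∈ 𝓑, ∀ ξ, ‖Tb B ξ‖ ≤ ‖T ξ‖)
    (hF₁ : ∀ B ∈ 𝓑, TayNormLE (Tb B) r₀ (W B) (F₁ B) (a₁ B))
    (hF₁' : ∀ B ∈ 𝓑, TayNormLE (Tb B) r₀ (W B) (F₁' B) (a₁ B))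
    (hΔ₁ : ∀ B ∈ 𝓑, TayNormLE (Tb B) r₀ (W B) (fun φ => F₁ B φ - F₁' B φ) (δ₁ B))
    (hF₁d : ∀ B ∈ 𝓑, ContDiff ℝ r₀ (F₁ B)) (hF₁'d : ∀ B ∈ 𝓑, ContDiff ℝ r₀ (F₁' B))
    (hF₁loc : ∀ B ∈ 𝓑, IsGaugeLocal (Tb B) (F₁ B)) (hF₁'loc : ∀ B ∈ 𝓑, IsGaugeLocal (Tb B) (F₁' B))
    (ha₁ : ∀ B ∈ 𝓑, 0 ≤ a₁ B) (hδ₁ : ∀ B ∈ 𝓑, 0 ≤ δ₁ B)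
    (hF₂ : ∀ B ∈ 𝓑, TayNormLE (Tb B) r₀ (W B) (F₂ B) (a₂ B))
    (hF₂' : ∀ B ∈ 𝓑, TayNormLE (Tb B) r₀ (W B) (F₂' B) (a₂ B))
    (hΔ₂ : ∀ B ∈ 𝓑, TayNormLE (Tb B) r₀ (W B) (fun φ => F₂ B φ - F₂' B φ) (δ₂ B))
    (hF₂d : ∀ B ∈ 𝓑, ContDiff ℝ r₀ (F₂ B)) (hF₂'d : ∀ B ∈ 𝓑, ContDiff ℝ r₀ (F₂' B))
    (hF₂loc : ∀ B ∈ 𝓑, IsGaugeLocal (Tb B) (F₂ B)) (hF₂'loc : ∀ B ∈ 𝓑, IsGaugeLocal (Tb B) (F₂' B))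
    (ha₂ : ∀ B ∈ 𝓑, 0 ≤ a₂ B) (hδ₂ : ∀ B ∈ 𝓑, 0 ≤ δ₂ B)
    (hF₃ : ∀ B ∈ 𝓑, TayNormLE (Tb B) r₀ (W B) (F₃ B) (a₃ B))
    (hF₃' : ∀ B ∈ 𝓑, TayNormLE (Tb B) r₀ (W B) (F₃' B) (a₃ B))
    (hΔ₃ : ∀ B ∈ 𝓑, TayNormLE (Tb B) r₀ (W B) (fun φ => F₃ B φ - F₃' B φ) (δ₃ B))
    (hF₃d : ∀ B ∈ 𝓑, ContDiff ℝ r₀ (F₃ B)) (hF₃'d : ∀ B ∈ 𝓑, ContDiff ℝ r₀ (F₃' B))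
    (hF₃loc : ∀ B ∈ 𝓑, IsGaugeLocal (Tb B) (F₃ B)) (hF₃'loc : ∀ B ∈ 𝓑, IsGaugeLocal (Tb B) (F₃' B))
    (ha₃ : ∀ B ∈ 𝓑, 0 ≤ a₃ B) (hδ₃ : ∀ B ∈ 𝓑, 0 ≤ δ₃ B)
    (hG : ∀ X ∈ 𝓧, ∀ X₁ ∈ polys s X, TayNormLE (Tp (X \ X₁)) r₀ (wm (X \ X₁)) (G (X \ X₁)) (g (X \ X₁)))
    (hΔG : ∀ X ∈ 𝓧, ∀ X₁ ∈ polys s X,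
      TayNormLE (Tp (X \ X₁)) r₀ (wm (X \ X₁)) (fun φ => G (X \ X₁) φ - G' (X \ X₁) φ) (ρ (X \ X₁)))
    (hGd : ∀ X ∈ 𝓧, ∀ X₁ ∈ polys s X, ContDiff ℝ r₀ (G (X \ X₁)))
    (hG'd : ∀ X ∈ 𝓧, ∀ X₁ ∈ polys s X, ContDiff ℝ r₀ (G' (X \ X₁)))
    (hGloc : ∀ X ∈ 𝓧, ∀ X₁ ∈ polys s X, IsGaugeLocal (Tp (X \ X₁)) (G (X \ X₁)))
    (hG'loc : ∀ X ∈ 𝓧, ∀ X₁ ∈ polys s X, IsGaugeLocal (Tp (X \ X₁)) (G' (X \ X₁)))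
    (hg : ∀ X ∈ 𝓧, ∀ X₁ ∈ polys s X, 0 ≤ g (X \ X₁)) (hρ : ∀ X ∈ 𝓧, ∀ X₁ ∈ polys s X, 0 ≤ ρ (X \ X₁))
    (hlep : ∀ X ∈ 𝓧, ∀ X₁ ∈ polys s X, ∀ ξ, ‖Tp (X \ X₁) ξ‖ ≤ ‖T ξ‖)
    (hw : ∀ X ∈ 𝓧, ∀ X₁ ∈ polys s X, ∀ φ, (∏ B ∈ blocks s (U \ X), W B φ) *
      (∏ B ∈ blocks s (X \ U), W B φ) * ((∏ B ∈ blocks s X₁, W B φ) * wm (X \ X₁) φ) ≤ w φ) :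
    TayNormLE T r₀ w
      (fun φ => ∑ X ∈ 𝓧, ∑ X₁ ∈ polys s X,
        (bprod s (fun B => F₁ B φ) (U \ X) * bprod s (fun B => F₂ B φ) (X \ U) *
            (bprod s (fun B => F₃ B φ) X₁ * G (X \ X₁) φ) -
          bprod s (fun B => F₁' B φ) (U \ X) * bprod s (fun B => F₂' B φ) (X \ U) *
            (bprod s (fun B => F₃' B φ) X₁ * G' (X \ X₁) φ)))
      (∑ X ∈ 𝓧, ∑ X₁ ∈ polys s X,
        (((∏ B ∈ blocks s (U \ X), (a₁ B + δ₁ B)) - ∏ B ∈ blocks s (U \ X), a₁ B) *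
            (∏ B ∈ blocks s (X \ U), a₂ B) * ((∏ B ∈ blocks s X₁, a₃ B) * g (X \ X₁)) +
          (∏ B ∈ blocks s (U \ X), a₁ B) *
            ((∏ B ∈ blocks s (X \ U), (a₂ B + δ₂ B)) - ∏ B ∈ blocks s (X \ U), a₂ B) *
            ((∏ B ∈ blocks s X₁, a₃ B) * g (X \ X₁)) +
          (∏ B ∈ blocks s (U \ X), a₁ B) * (∏ B ∈ blocks s (X \ U), a₂ B) *
            (((∏ B ∈ blocks s X₁, (a₃ B + δ₃ B)) - ∏ B ∈ blocks s X₁, a₃ B) * g (X \ X₁)) +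
          (∏ B ∈ blocks s (U \ X), a₁ B) * (∏ B ∈ blocks s (X \ U), a₂ B) *
            ((∏ B ∈ blocks s X₁, a₃ B) * ρ (X \ X₁)))) := by
  have hcd : ∀ {F : Finset (Fin d → ZMod M) → ((Fin d → ZMod M) → ℝ) → ℂ} {Z : Finset (Fin d → ZMod M)},
      (∀ B ∈ blocks s Z, ContDiff ℝ r₀ (F B)) → ContDiff ℝ r₀ (fun φ => bprod s (fun B => F B φ) Z) := by
    intro F Z hF
    unfold TorusPolymer.bprod
    exact contDiff_prod fun B hB => hF B hB
  have hterm_cd : ∀ X ∈ 𝓧, ∀ X₁ ∈ polys s X, ContDiff ℝ r₀ (fun φ =>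
      bprod s (fun B => F₁ B φ) (U \ X) * bprod s (fun B => F₂ B φ) (X \ U) *
          (bprod s (fun B => F₃ B φ) X₁ * G (X \ X₁) φ) -
        bprod s (fun B => F₁' B φ) (U \ X) * bprod s (fun B => F₂' B φ) (X \ U) *
          (bprod s (fun B => F₃' B φ) X₁ * G' (X \ X₁) φ)) := by
    intro X hX X₁ hX₁
    have h3sub : blocks s X₁ ⊆ 𝓑 := (TorusPolymer.blocks_mono s (mem_polys.1 hX₁).1).trans (h𝓑₃ X hX)
    exact (((hcd fun B hB => hF₁d B (h𝓑₁ X hX hB)).mul (hcd fun B hB => hF₂d B (h𝓑₂ X hX hB))).mul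
        ((hcd fun B hB => hF₃d B (h3sub hB)).mul (hGd X hX X₁ hX₁))).sub
      (((hcd fun B hB => hF₁'d B (h𝓑₁ X hX hB)).mul (hcd fun B hB => hF₂'d B (h𝓑₂ X hX hB))).mul
        ((hcd fun B hB => hF₃'d B (h3sub hB)).mul (hG'd X hX X₁ hX₁)))
  refine TayNormLE.sum (T := T) (r₀ := r₀) (w := w) 𝓧 (fun X hX => ?_) (fun X hX => ?_)
  · refine TayNormLE.sum (T := T) (r₀ := r₀) (w := w) (polys s X) (fun X₁ hX₁ => ?_)
      (fun X₁ hX₁ => hterm_cd X hX X₁ hX₁)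
    have h3sub : blocks s X₁ ⊆ 𝓑 := (TorusPolymer.blocks_mono s (mem_polys.1 hX₁).1).trans (h𝓑₃ X hX)
    exact tayNormLE_reblockTerm_sub s T Tb (Tp (X \ X₁)) hU (h𝓧 X hX) hX₁
      (fun B hB => hF₁ B (h𝓑₁ X hX hB)) (fun B hB => hF₁' B (h𝓑₁ X hX hB))
      (fun B hB => hΔ₁ B (h𝓑₁ X hX hB)) (fun B hB => hF₁d B (h𝓑₁ X hX hB))
      (fun B hB => hF₁'d B (h𝓑₁ X hX hB)) (fun B hB => hF₁loc B (h𝓑₁ X hX hB))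
      (fun B hB => hF₁'loc B (h𝓑₁ X hX hB)) (fun B hB => ha₁ B (h𝓑₁ X hX hB))
      (fun B hB => hδ₁ B (h𝓑₁ X hX hB)) (fun B hB => hle B (h𝓑₁ X hX hB))
      (fun B hB => hF₂ B (h𝓑₂ X hX hB)) (fun B hB => hF₂' B (h𝓑₂ X hX hB))
      (fun B hB => hΔ₂ B (h𝓑₂ X hX hB)) (fun B hB => hF₂d B (h𝓑₂ X hX hB))
      (fun B hB => hF₂'d B (h𝓑₂ X hX hB)) (fun B hB => hF₂loc B (h𝓑₂ X hX hB))
      (fun B hB => hF₂'loc B (h𝓑₂ X hX hB)) (fun B hB => ha₂ B (h𝓑₂ X hX hB))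
      (fun B hB => hδ₂ B (h𝓑₂ X hX hB)) (fun B hB => hle B (h𝓑₂ X hX hB))
      (fun B hB => hF₃ B (h3sub hB)) (fun B hB => hF₃' B (h3sub hB))
      (fun B hB => hΔ₃ B (h3sub hB)) (fun B hB => hF₃d B (h3sub hB))
      (fun B hB => hF₃'d B (h3sub hB)) (fun B hB => hF₃loc B (h3sub hB))
      (fun B hB => hF₃'loc B (h3sub hB)) (fun B hB => ha₃ B (h3sub hB))
      (fun B hB => hδ₃ B (h3sub hB)) (fun B hB => hle B (h3sub hB))
      (hG X hX X₁ hX₁) (hΔG X hX X₁ hX₁) (hGd X hX X₁ hX₁) (hG'd X hX X₁ hX₁)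
      (hGloc X hX X₁ hX₁) (hG'loc X hX X₁ hX₁) (hg X hX X₁ hX₁) (hρ X hX X₁ hX₁) (hlep X hX X₁ hX₁)
      (hw X hX X₁ hX₁)
  · exact ContDiff.sum fun X₁ hX₁ => hterm_cd X hX X₁ hX₁

end Literature.MathematicalPhysics.StatisticalMechanics.GradientRG

end
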